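import Summits.CriticalPhenomena.PercolationContinuityZ3.Theorems.PercNearOneGluingNoHeavyLowerTailIncStarApexForest
import Summits.CriticalPhenomena.PercolationContinuityZ3.Theorems.PercNearOneGluingNoHeavyLowerTailFrontierDecRowsEdgeInduction
import HarnessLib

/-!
# The increasing star from the endpoint-minimum property along environment pairs (schema for CONJECTURE E-MIN)

Support file for the Sahi programme (`--supports stmt-CriticalPhenomena-4575`, prover prim-sahi-p2 gen 23).  No definitions, no named
facts, no sorries; standard axioms.  Memo `prim-sahi-p2/gen21/THEOREM-H.md` §5 (CONJECTURE E-MIN, ≈74 000 adversarial instances, no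
violation), `prim-sahi-p2/PROOF-E3.md` (31g), §33.

CONJECTURE E-MIN (gen 21): along every pair `e` of every weight the cubic `q ↦ E₃^{w[e↦q]}({s↔a},{s↔b},{s↔c})` attains its minimum over
`[0,1]` at an endpoint.  **Schema `incStar_of_endpointMin`**: if at every weight with a fractional ENVIRONMENT pair (a non-loop pair avoiding the
root with weight strictly between `0` and `1`) SOME such pair `e` has `E₃(w) ≥ E₃(w[e↦0])` or `E₃(w) ≥ E₃(w[e↦1])`, then the increasing star
`0 ≤ E₃({s↔a},{s↔b},{s↔c})` holds for every weight on `Fin n`.  Proof: induction on the number of fractional environment pairs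
(`EdgeInduction.fracEdges`); when there is none, every environment pair of positive weight has weight `1`, so every environment cycle is sure
and gen 19's THEOREM C♯ `IncStar.incStar_nonneg_of_sureEnvCycles` applies (the root pairs stay arbitrary throughout).  Thus E-MIN — indeed
E-MIN for one fractional environment pair per weight — implies the increasing star; by `…IncStarIrreducibleTwo` it would suffice on irreducible
marked graphs with 2-connected environment of cyclomatic number `≥ 2`.
-/

noncomputable section

namespace Summit.CriticalPhenomena.PercolationContinuityZ3.Theorems

namespace IncStar

open MeasureTheory Set Literature.Probability.Percolation Literature.Probability.LatticeModels EdgeInduction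
open scoped Classical

variable {n : ℕ}

/-- **The increasing star from the endpoint-minimum property (schema for CONJECTURE E-MIN).**  If at every weight having a fractional
environment pair some fractional environment pair `e` satisfies `E₃(w[e↦0]) ≤ E₃(w)` or `E₃(w[e↦1]) ≤ E₃(w)` (for the given root and targets),
then `0 ≤ E₃({s↔a},{s↔b},{s↔c})` for every weight. [this work] -/
theorem incStar_of_endpointMin (s a b c : Fin n)
    (H : ∀ w : Sym2 (Fin n) → unitInterval,
      (∃ e : Sym2 (Fin n), s ∉ e ∧ ¬ e.IsDiag ∧ e ∈ fracEdges w) →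
      ∃ e : Sym2 (Fin n), s ∉ e ∧ ¬ e.IsDiag ∧ e ∈ fracEdges w ∧
        (sahiE3 (prodBernoulli (Function.update w e 0)) (openConn s a) (openConn s b) (openConn s c)
            ≤ sahiE3 (prodBernoulli w) (openConn s a) (openConn s b) (openConn s c) ∨
          sahiE3 (prodBernoulli (Function.update w e 1)) (openConn s a) (openConn s b) (openConn s c)
            ≤ sahiE3 (prodBernoulli w) (openConn s a) (openConn s b) (openConn s c)))
    (w : Sym2 (Fin n) → unitInterval) :
    0 ≤ sahiE3 (prodBernoulli w) (openConn s a) (openConn s b) (openConn s c) := by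
  -- induction on the number of fractional environment pairs
  suffices main : ∀ (k : ℕ) (w : Sym2 (Fin n) → unitInterval),
      ((fracEdges w).filter fun e => s ∉ e ∧ ¬ e.IsDiag).card ≤ k →
      0 ≤ sahiE3 (prodBernoulli w) (openConn s a) (openConn s b) (openConn s c) from main _ w le_rfl
  intro k
  induction k with
  | zero =>
    intro w hk
    -- no fractional environment pair: every environment pair of positive weight has weight `1`
    refine incStar_nonneg_of_sureEnvCycles w s a b c fun u v hadj hne => ?_
    exfalso
    rw [SimpleGraph.fromEdgeSet_adj] at hadj
    obtain ⟨⟨hs, hw0⟩, huv⟩ := hadj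
    have hmem : s(u, v) ∈ (fracEdges w).filter fun e => s ∉ e ∧ ¬ e.IsDiag := by
      refine Finset.mem_filter.2 ⟨?_, hs, by rwa [Sym2.mk_isDiag_iff]⟩
      by_contra h
      rcases eq_zero_or_one_of_not_mem_fracEdges h with h0 | h1
      · exact hw0 h0
      · exact hne h1
    have := Finset.card_pos.2 ⟨_, hmem⟩
    omega
  | succ k ih =>
    intro w hk
    by_cases hex : ∃ e : Sym2 (Fin n), s ∉ e ∧ ¬ e.IsDiag ∧ e ∈ fracEdges w
    swap
    · -- nothing fractional in the environment: the base case again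
      refine ih w ?_
      have h0 : ((fracEdges w).filter fun e => s ∉ e ∧ ¬ e.IsDiag) = ∅ := by
        refine Finset.eq_empty_of_forall_notMem fun e he => ?_
        rw [Finset.mem_filter] at he
        exact hex ⟨e, he.2.1, he.2.2, he.1⟩
      rw [h0, Finset.card_empty]; exact Nat.zero_le _
    obtain ⟨e, hse, hnd, hfr, hmin⟩ := H w hex
    have hmemf : e ∈ (fracEdges w).filter fun f => s ∉ f ∧ ¬ f.IsDiag := Finset.mem_filter.2 ⟨hfr, hse, hnd⟩
    have hcard : ∀ (u : unitInterval), u = 0 ∨ u = 1 →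
        ((fracEdges (Function.update w e u)).filter fun f => s ∉ f ∧ ¬ f.IsDiag).card ≤ k := by
      intro u hu
      have hsub : ((fracEdges (Function.update w e u)).filter fun f => s ∉ f ∧ ¬ f.IsDiag) ⊆
          ((fracEdges w).filter fun f => s ∉ f ∧ ¬ f.IsDiag).erase e := by
        intro f hf
        rw [Finset.mem_filter] at hf
        have hf' := fracEdges_update_subset w e u hu hf.1
        rw [Finset.mem_erase] at hf' ⊢
        exact ⟨hf'.1, Finset.mem_filter.2 ⟨hf'.2, hf.2⟩⟩
      have h1 := Finset.card_le_card hsub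
      rw [Finset.card_erase_of_mem hmemf] at h1
      omega
    rcases hmin with h0 | h1
    · exact le_trans (ih _ (hcard 0 (Or.inl rfl))) h0
    · exact le_trans (ih _ (hcard 1 (Or.inr rfl))) h1

end IncStar

end Summit.CriticalPhenomena.PercolationContinuityZ3.Theorems
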